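import Mathlib
import Summits.Ventures.HodgeRepro.Tier4.Line1.RTFSetting
import Summits.Ventures.HodgeRepro.Tier4.Line1.RtfUnfold
import Summits.Ventures.HodgeRepro.Tier4.Line1.RtfSpectralStep
import Summits.Ventures.HodgeRepro.Tier4.Line1.KernelUnfold
import Summits.Ventures.HodgeRepro.Tier4.Line1.KernelSpectral

/-!
# Tier4/Line1/RtfSpectral — LINE L1, lemma L1.2b `rtf_spectral`: the spectral expansion of `J(f₁ ⋆ f₂)`

Blind re-derivation cell `pub-hodge-repro`, Tier 4 «prove the step» (README §9–§10), seat t4-L1-p4 (prover, gen 0;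
lead S12132 / S12152: t4-L1-p4 = L1.2b).  LINE L1 = the relative-trace-formula line of t4-plan-1 (Skeleton v0.8
12c8528bc811170c L434–L439 = v0.15 L284; «LINE L1 FILED» S12152 / S12441).

THE LEMMA, statement BYTE-IDENTICAL to the skeleton, is the composition of two landed modules:
* L1.2a `kernel_spectral` (t4-L1-p3, `Tier4/Line1/KernelSpectral.lean` ← `KernelUnfold.lean`): the POINTWISE expansion
  `∀ x y, HasSum (fun j => R(f₂ˇ)φ_j(y) · conj(R(f̄₁)φ_j(x))) (K_{f₁⋆f₂}(x, y))` — Parseval in `L²(DG)` for the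
  complete orthonormal family;
* L1.2b's integration step `rtf_spectral_of_kernel_spectral` (t4-L1-p4, `Tier4/Line1/RtfSpectralStep.lean` ←
  `RtfUnfold.lean`): dominated convergence on `(μT|DT) ⊗ (μT′|DT′)` with the Bessel bound
  `∑_j ‖R(f)φ_j(y)‖² ≤ M` uniform on compacts (paper: proofs/t4/L1/L1.2b.md).
`#print axioms rtf_spectral` = [propext, Classical.choice, Quot.sound].

Nothing here says anything about the status of the Hodge conjecture for CM abelian varieties, which is NOT proved;
HC_CM is NOT proved by anyone in this repository.
-/

set_option autoImplicit false

noncomputable section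

namespace Summit.Ventures.HodgeRepro.Tier4.Line1

open MeasureTheory Topology

namespace RTF

variable {G : Type} [Group G] [TopologicalSpace G] [IsTopologicalGroup G] [MeasurableSpace G]
  [BorelSpace G]

namespace Setting

variable (S : Setting G)

/-- L1.2b (M): the spectral expansion of `J(f₁ ⋆ f₂)` (dominated convergence on the finite-measure
domain `DT × DT'`, the partial sums bounded by Cauchy–Schwarz). -/
theorem rtf_spectral {χ : S.T → ℂ} {χ' : S.T' → ℂ} (hχ : S.IsCharacter χ) (hχ' : S.IsCharacter' χ')
    {τ : ℕ → Set (G → ℂ)} {φ : ℕ → G → ℂ} {n : ℕ → ℕ} (hB : S.IsAdaptedONB τ φ n)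
    {f₁ f₂ : G → ℂ} (h₁ : IsTest f₁) (h₂ : IsTest f₂) :
    HasSum (fun j => S.periodT' χ' (fun t' => S.R (refl f₂) (φ j) t') *
        starRingEnd ℂ (S.periodT χ (fun t => S.R (cj f₁) (φ j) t)))
      (S.J χ χ' (S.conv f₁ f₂)) :=
  S.rtf_spectral_of_kernel_spectral hχ hχ' hB h₁ h₂ fun x y => S.kernel_spectral hB h₁ h₂ x y

end Setting

end RTF

end Summit.Ventures.HodgeRepro.Tier4.Line1
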